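import Mathlib
import Summits.Ventures.PercRepro2.Defs
import Summits.Ventures.PercRepro2.Graph
import Summits.Ventures.PercRepro2.OneColourSwitch
import Summits.Ventures.PercRepro2.RegionHubSign
import Summits.Ventures.PercRepro2.SideSwitch
import Summits.Ventures.PercRepro2.M9NoPocketDefs
import Summits.Ventures.PercRepro2.M9PocketRSEdgeTransfer
import Summits.Ventures.PercRepro2.M9PocketRootOnlyTransfer
import Summits.Ventures.PercRepro2.M9PocketRSDTransfer

/-!
# A cluster hanging from `{r, s, d}` — the link `r ~ s` is the join (blind cell PercRepro2,
p3 g42, 2026-08-30; `proofs/P3-POCKETRK.md` §10⁶ (a) (vi))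

With `L`, `F` as in `M9PocketRSDTransfer`: `r ~_Y s` in `G` iff `r` and `s` are joined in the
JOIN of the exit relations of `G − F` and of the `F`-graph — `r, s` joined by a segment of
either graph, or both joined to `d` by such segments (on three exits a chain of length at most
two suffices; `join_step_rsd` is the one-step closure of the join class of `r`,
`conn_rs_iff_join_rsd` the theorem).  Applied to the colour flip it gives the `W`-link.
Own work; std axioms.
-/

namespace Summit.Ventures.PercRepro2

namespace NoPocket

open Finset Classical OneColourSwitch SideSwitch

variable {V : Type*} {E : Type*} {ends : E → Sym2 V} {p q r s d : V} {ω : Config E} {L : Set V}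

section Join

/-- The join of the exit relations of `G − F` and the `F`-graph, for the pair `r, s`: the
class of `s` in the chain relation of length at most two through `d`. -/
lemma join_step_rsd
    {T : V → V → Prop} {t' a : V}
    (ht' : t' = r ∨ t' = s ∨ t' = d) (ha : a = r ∨ a = s ∨ a = d)
    (hJ : (t' = r) ∨ (t' = s ∧ (T r s ∨ (T r d ∧ T d s))) ∨ (t' = d ∧ (T r d ∨ (T r s ∧ T s d))))
    (hta : T t' a) :
    (a = r) ∨ (a = s ∧ (T r s ∨ (T r d ∧ T d s))) ∨ (a = d ∧ (T r d ∨ (T r s ∧ T s d))) := by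
  rcases ha with rfl | rfl | rfl
  · exact Or.inl rfl
  · refine Or.inr (Or.inl ⟨rfl, ?_⟩)
    rcases hJ with rfl | ⟨rfl, hJ⟩ | ⟨rfl, hJ⟩
    · exact Or.inl hta
    · exact hJ
    · rcases hJ with hJ | ⟨hJ1, _⟩
      · exact Or.inr ⟨hJ, hta⟩
      · exact Or.inl hJ1
  · refine Or.inr (Or.inr ⟨rfl, ?_⟩)
    rcases hJ with rfl | ⟨rfl, hJ⟩ | ⟨rfl, hJ⟩
    · exact Or.inl hta
    · rcases hJ with hJ | ⟨hJ1, _⟩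
      · exact Or.inr ⟨hJ, hta⟩
      · exact Or.inl hJ1
    · exact hJ

/-- **The link `r ~_Y s` is the join**: `r ~ s` in `G` iff `r, s` are joined by a segment of
`G − F` or of the `F`-graph, or both are so joined to `d`. -/
lemma conn_rs_iff_join_rsd
    (hL : ∀ e x y, ends e = s(x, y) → x ∈ L → y ∈ L ∨ y = r ∨ y = s ∨ y = d)
    (hr : r ∉ L) (hs : s ∉ L) (hd : d ∉ L) :
    Conn ends ω r s ↔
      (Conn (fun e : {e // e ∉ within ends (L ∪ {r, s, d} : Set V)} => ends e.1) (fun e => ω e.1)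
          r s ∨
        Conn (fun e : {e // ¬ (e ∉ within ends (L ∪ {r, s, d} : Set V))} => ends e.1)
          (fun e => ω e.1) r s) ∨
      ((Conn (fun e : {e // e ∉ within ends (L ∪ {r, s, d} : Set V)} => ends e.1) (fun e => ω e.1)
          r d ∨
        Conn (fun e : {e // ¬ (e ∉ within ends (L ∪ {r, s, d} : Set V))} => ends e.1)
          (fun e => ω e.1) r d) ∧
       (Conn (fun e : {e // e ∉ within ends (L ∪ {r, s, d} : Set V)} => ends e.1) (fun e => ω e.1)
          d s ∨
        Conn (fun e : {e // ¬ (e ∉ within ends (L ∪ {r, s, d} : Set V))} => ends e.1)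
          (fun e => ω e.1) d s)) := by
  -- the exit relation `T a b` := joined by a segment of either graph
  have hTconn : ∀ a b,
      (Conn (fun e : {e // e ∉ within ends (L ∪ {r, s, d} : Set V)} => ends e.1) (fun e => ω e.1)
          a b ∨
        Conn (fun e : {e // ¬ (e ∉ within ends (L ∪ {r, s, d} : Set V))} => ends e.1)
          (fun e => ω e.1) a b) → Conn ends ω a b := by
    rintro a b (h | h)
    · exact conn_of_conn_restrict h
    · exact conn_of_conn_restrict h
  constructor
  · intro h
    -- closure: every vertex reached from `r` is reached by a segment from an exit in the
    -- join class of `r`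
    have key : s ∈ {z | ∃ t', (t' = r ∨ t' = s ∨ t' = d) ∧
        ((t' = r) ∨ (t' = s ∧ ((fun a b => Conn (fun e : {e // e ∉ within ends (L ∪ {r, s, d} : Set V)} => ends e.1)
          (fun e => ω e.1) a b ∨
        Conn (fun e : {e // ¬ (e ∉ within ends (L ∪ {r, s, d} : Set V))} => ends e.1)
          (fun e => ω e.1) a b) r s ∨ ((fun a b => Conn (fun e : {e // e ∉ within ends (L ∪ {r, s, d} : Set V)} => ends e.1)
          (fun e => ω e.1) a b ∨
        Conn (fun e : {e // ¬ (e ∉ within ends (L ∪ {r, s, d} : Set V))} => ends e.1)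
          (fun e => ω e.1) a b) r d ∧ (fun a b => Conn (fun e : {e // e ∉ within ends (L ∪ {r, s, d} : Set V)} => ends e.1)
          (fun e => ω e.1) a b ∨
        Conn (fun e : {e // ¬ (e ∉ within ends (L ∪ {r, s, d} : Set V))} => ends e.1)
          (fun e => ω e.1) a b) d s))) ∨
          (t' = d ∧ ((fun a b => Conn (fun e : {e // e ∉ within ends (L ∪ {r, s, d} : Set V)} => ends e.1)
          (fun e => ω e.1) a b ∨
        Conn (fun e : {e // ¬ (e ∉ within ends (L ∪ {r, s, d} : Set V))} => ends e.1)
          (fun e => ω e.1) a b) r d ∨ ((fun a b => Conn (fun e : {e // e ∉ within ends (L ∪ {r, s, d} : Set V)} => ends e.1)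
          (fun e => ω e.1) a b ∨
        Conn (fun e : {e // ¬ (e ∉ within ends (L ∪ {r, s, d} : Set V))} => ends e.1)
          (fun e => ω e.1) a b) r s ∧ (fun a b => Conn (fun e : {e // e ∉ within ends (L ∪ {r, s, d} : Set V)} => ends e.1)
          (fun e => ω e.1) a b ∨
        Conn (fun e : {e // ¬ (e ∉ within ends (L ∪ {r, s, d} : Set V))} => ends e.1)
          (fun e => ω e.1) a b) s d)))) ∧
        (fun a b => Conn (fun e : {e // e ∉ within ends (L ∪ {r, s, d} : Set V)} => ends e.1)
          (fun e => ω e.1) a b ∨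
        Conn (fun e : {e // ¬ (e ∉ within ends (L ∪ {r, s, d} : Set V))} => ends e.1)
          (fun e => ω e.1) a b) t' z} := by
      refine mem_of_conn_of_closed ?_ ⟨r, Or.inl rfl, Or.inl rfl, Or.inl (conn_refl _ _ _)⟩ h
      rintro a ⟨t', ht', hJ, ha⟩ b hab
      simp only [Set.mem_setOf_eq]
      obtain ⟨_, e, he, hends⟩ := openGraph_adj.1 hab
      have ht'L : t' ∉ L := by rcases ht' with rfl | rfl | rfl <;> assumption
      by_cases hP : e ∈ within ends (L ∪ {r, s, d} : Set V)
      · have hadj : Conn (fun e : {e // ¬ (e ∉ within ends (L ∪ {r, s, d} : Set V))} => ends e.1)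
            (fun e => ω e.1) a b :=
          conn_of_openAdj ⟨⟨e, not_not.2 hP⟩, he, hends⟩
        rcases ha with ha | ha
        · -- switch of graph at the exit `a`
          have haL : a ∉ L := notMem_L_of_conn_restrict_rsd hL ht'L ha
          have haE : a = r ∨ a = s ∨ a = d :=
            exit_of_mem_of_notMem (mem_of_mem_within hP hends).1 haL
          exact ⟨a, haE, join_step_rsd (T := (fun a b => Conn (fun e : {e // e ∉ within ends (L ∪ {r, s, d} : Set V)} => ends e.1)
          (fun e => ω e.1) a b ∨
        Conn (fun e : {e // ¬ (e ∉ within ends (L ∪ {r, s, d} : Set V))} => ends e.1)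
          (fun e => ω e.1) a b)) ht' haE hJ (Or.inl ha), Or.inr hadj⟩
        · exact ⟨t', ht', hJ, Or.inr (conn_trans ha hadj)⟩
      · have hadj : Conn (fun e : {e // e ∉ within ends (L ∪ {r, s, d} : Set V)} => ends e.1)
            (fun e => ω e.1) a b :=
          conn_of_openAdj ⟨⟨e, hP⟩, he, hends⟩
        have haL : a ∉ L := (notMem_L_of_notMem_within_rsd hL hP hends).1
        rcases ha with ha | ha
        · exact ⟨t', ht', hJ, Or.inl (conn_trans ha hadj)⟩
        · have haE : a = r ∨ a = s ∨ a = d :=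
            exit_of_mem_of_notMem
              (mem_of_conn_F_rsd (by rcases ht' with rfl | rfl | rfl <;> simp) ha) haL
          exact ⟨a, haE, join_step_rsd (T := (fun a b => Conn (fun e : {e // e ∉ within ends (L ∪ {r, s, d} : Set V)} => ends e.1)
          (fun e => ω e.1) a b ∨
        Conn (fun e : {e // ¬ (e ∉ within ends (L ∪ {r, s, d} : Set V))} => ends e.1)
          (fun e => ω e.1) a b)) ht' haE hJ (Or.inr ha), Or.inl hadj⟩
    obtain ⟨t', ht', hJ, hts⟩ := key
    have hJs := join_step_rsd (T := (fun a b => Conn (fun e : {e // e ∉ within ends (L ∪ {r, s, d} : Set V)} => ends e.1)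
          (fun e => ω e.1) a b ∨
        Conn (fun e : {e // ¬ (e ∉ within ends (L ∪ {r, s, d} : Set V))} => ends e.1)
          (fun e => ω e.1) a b)) ht' (Or.inr (Or.inl rfl)) hJ hts
    rcases hJs with hJs | ⟨_, hJs⟩ | ⟨hJs, _⟩
    · -- `s = r`: then `r ~ s` trivially in the restriction
      exact Or.inl (Or.inl (hJs ▸ conn_refl _ _ _))
    · rcases hJs with hJs | ⟨h1, h2⟩
      · exact Or.inl hJs
      · exact Or.inr ⟨h1, h2⟩
    · -- `s = d`: `r ~ s` iff `r ~ d`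
      rcases hJ with rfl | ⟨rfl, hJ⟩ | ⟨rfl, hJ⟩
      · exact Or.inl (hJs ▸ hts)
      · rcases hJ with hJ | ⟨h1, _⟩
        · exact Or.inl hJ
        · exact Or.inl (hJs ▸ h1)
      · rcases hJ with hJ | ⟨h1, _⟩
        · exact Or.inl (hJs ▸ hJ)
        · exact Or.inl h1
  · rintro (h | ⟨h1, h2⟩)
    · exact hTconn r s h
    · exact conn_trans (hTconn r d h1) (hTconn d s h2)

end Join

end NoPocket

end Summit.Ventures.PercRepro2
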